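import Summits.AtomisticToContinuum.HydrodynamicLimit.Theses.OneFlightGossipEngine
import Summits.AtomisticToContinuum.HydrodynamicLimit.Theorems.OneFlightGossipEngineEnergyCurrentTailsLevelCensusEventMeasurable
import Literature.Analysis.FluidPDE.EmpiricalCollisionMeasureMeasurableLabels
import Literature.MathematicalPhysics.KineticTheory.HardSphereEuler
import HarnessLib

/-!
# Transfer-activity tails from the momentum- and the energy-activity tails (stub `stub_transferActivityTails`)

Crux `Summit.AtomisticToContinuum.HydrodynamicLimit.Theses.OneFlightGossipEngine.ClampedCurrentsDock`
(stmt-AtomisticToContinuum-14680), line `IdeatorTwoSketch`, registered stub CC3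
`stub_transferActivityTails : TransferActivityTailsOf` (the defs `CollisionEnergyActivityTails`,
`TransferActivityTails`, `TransferActivityTailsOf` re-declared verbatim from the line skeleton;
`CollisionActivityTails` is the route's). The clamp of the collisional large-deviation input of Yau's ledger uses
the TRANSFER activity `a_i = a_i^m + a_i^e` of particle `i` over the window `(s, s + w]`, `w = τ (N+1)^{-1/3}`
(momentum activity `a_i^m = (σ/τ) Σ_{coll of i} ‖v⁺ − v⁻‖` plus energy activity
`a_i^e = (σ/τ) Σ_{coll of i} |‖v⁺‖² − ‖v⁻‖²|/2`), and the ledger needs the `L¹` tail bound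
`E_λ[(N+1)⁻¹ Σ_i a_i 𝟙{a_i > V}] ≤ ε` at every fixed large level; it follows from the same statement for `a^m`
(`CollisionActivityTails`, stmt-13734) and for `a^e` (`CollisionEnergyActivityTails`) at level `V/2` and accuracy
`ε/4`: pointwise `(p + q) 𝟙{p + q > V} ≤ 2 p 𝟙{p > V/2} + 2 q 𝟙{q > V/2}` for `p, q ≥ 0`
(`indicator_add_le_two_mul_add`), the activities split on the good set (`collisionSum_transfer_eq_add`, full
measure under the local Gibbs law), and `lintegral` additivity through the a.e.-measurability of the momentum
activity (re-proved inline after the in-band twin 9133's `HydroLimitInBandContinuity.aemeasurable_momActivity`: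
the label-aware collision-sum engine `HardSphereFlow.aemeasurable_of_eqOn_collisionSum_labels_torus` through the
elastic law read off the mark, `EnergyCurrentTailsLevelCensus.ofConfig_postVel_eq_of_mem_contactSet`).

Reference: H.-T. Yau, Lett. Math. Phys. 22 (1991) §2 (the clamp of the collisional currents).
-/

noncomputable section

namespace Summit.AtomisticToContinuum.HydrodynamicLimit.Theorems.ClampedCurrentsDockTransferTails

open scoped BigOperators ENNReal Classical Interval
open MeasureTheory Filter Set Topology InformationTheory
open Literature.MathematicalPhysics.KineticTheory Literature.Analysis.FluidPDE Literature.Analysis.FunctionSpaces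
open Summit.AtomisticToContinuum.HydrodynamicLimit.Theses.OneFlightGossipEngine
open Summit.AtomisticToContinuum.HydrodynamicLimit.Theorems
open scoped InnerProductSpace
open Summit.AtomisticToContinuum.HydrodynamicLimit.Theorems.EnergyCurrentTailsLevelCensus
  (ofConfig_postVel_eq_of_mem_contactSet)

/-! ## The statements (verbatim from the line skeleton) -/

/-- registered stub signature (input CEAT of CC3) of line IdeatorTwoSketch, crux ClampedCurrentsDock — route-internal,
not a cited fact -/
def CollisionEnergyActivityTails : Prop :=
  ∀ (a₀ θ₀ : T3 → ℝ) (u₀ : T3 → V3), Continuous a₀ → Continuous θ₀ → Continuous u₀ → (∀ x, 0 < a₀ x) →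
    (∀ x, 0 < θ₀ x) → ∃ σ₀ : ℝ, 0 < σ₀ ∧ ∀ σ : ℝ, 0 < σ → σ < σ₀ →
    ∀ (T : ℝ) (ρ θ : ℝ → T3 → ℝ) (u : ℝ → T3 → V3), IsHardSphereEulerSolution σ T ρ u θ →
    ∀ Φ : (N : ℕ) → HardSphereFlow (Torus.geometry (Fin 3)) (hsDiameter σ N) (N + 1),
    TendstoHydroFieldsAt (fun N => localGibbsLaw σ a₀ u₀ θ₀ N (Φ N)) Φ ρ u θ 0 →
    ∀ t ∈ Set.Ico 0 T, ∃ V₀ : ℝ, 0 < V₀ ∧ ∀ V : ℝ, V₀ ≤ V → ∀ ε : ℝ, 0 < ε → ∃ τ₀ : ℝ, 0 < τ₀ ∧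
    ∀ τ : ℝ, τ₀ ≤ τ → ∃ N₀ : ℕ, ∀ N : ℕ, N₀ ≤ N → ∀ s ∈ Set.Icc 0 t,
      (let w : ℝ := τ * ((N : ℝ) + 1) ^ (-(1 / 3 : ℝ))
       let P := localGibbsLaw σ a₀ u₀ θ₀ N (Φ N)
       let act := fun (i : Fin (N + 1)) (z : Config (N + 1) (Fin 3) T3) =>
         σ / τ * (Φ N).collisionSum (Set.Ioc s (s + w))
           (fun c => if c.fst = i then |‖c.postVel.1‖ ^ 2 - ‖c.preVel.1‖ ^ 2| / 2 else 0) z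
       ∫⁻ z, ENNReal.ofReal (((N : ℝ) + 1)⁻¹ * ∑ i : Fin (N + 1),
           Set.indicator {y : ℝ | V < y} (fun y => y) (act i z)) ∂P ≤ ENNReal.ofReal ε)

/-- registered stub signature (conclusion of CC3) of line IdeatorTwoSketch, crux ClampedCurrentsDock — route-internal,
not a cited fact -/
def TransferActivityTails : Prop :=
  ∀ (a₀ θ₀ : T3 → ℝ) (u₀ : T3 → V3), Continuous a₀ → Continuous θ₀ → Continuous u₀ → (∀ x, 0 < a₀ x) →
    (∀ x, 0 < θ₀ x) → ∃ σ₀ : ℝ, 0 < σ₀ ∧ ∀ σ : ℝ, 0 < σ → σ < σ₀ →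
    ∀ (T : ℝ) (ρ θ : ℝ → T3 → ℝ) (u : ℝ → T3 → V3), IsHardSphereEulerSolution σ T ρ u θ →
    ∀ Φ : (N : ℕ) → HardSphereFlow (Torus.geometry (Fin 3)) (hsDiameter σ N) (N + 1),
    TendstoHydroFieldsAt (fun N => localGibbsLaw σ a₀ u₀ θ₀ N (Φ N)) Φ ρ u θ 0 →
    ∀ t ∈ Set.Ico 0 T, ∃ V₀ : ℝ, 0 < V₀ ∧ ∀ V : ℝ, V₀ ≤ V → ∀ ε : ℝ, 0 < ε → ∃ τ₀ : ℝ, 0 < τ₀ ∧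
    ∀ τ : ℝ, τ₀ ≤ τ → ∃ N₀ : ℕ, ∀ N : ℕ, N₀ ≤ N → ∀ s ∈ Set.Icc 0 t,
      (let w : ℝ := τ * ((N : ℝ) + 1) ^ (-(1 / 3 : ℝ))
       let P := localGibbsLaw σ a₀ u₀ θ₀ N (Φ N)
       let act := fun (i : Fin (N + 1)) (z : Config (N + 1) (Fin 3) T3) =>
         σ / τ * (Φ N).collisionSum (Set.Ioc s (s + w))
           (fun c => if c.fst = i then ‖c.postVel.1 - c.preVel.1‖ + |‖c.postVel.1‖ ^ 2 - ‖c.preVel.1‖ ^ 2| / 2 else 0) z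
       ∫⁻ z, ENNReal.ofReal (((N : ℝ) + 1)⁻¹ * ∑ i : Fin (N + 1),
           Set.indicator {y : ℝ | V < y} (fun y => y) (act i z)) ∂P ≤ ENNReal.ofReal ε)

/-- registered stub signature CC3 `stub_transferActivityTails` of line IdeatorTwoSketch, crux ClampedCurrentsDock —
route-internal, not a cited fact -/
def TransferActivityTailsOf : Prop :=
  CollisionActivityTails → CollisionEnergyActivityTails → TransferActivityTails

/-! ## §1 The pointwise splitting inequality -/

/-- For `p, q ≥ 0`: `(p + q) 𝟙{V < p + q} ≤ 2 p 𝟙{V/2 < p} + 2 q 𝟙{V/2 < q}` (if `p + q > V` then the larger of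
`p, q` exceeds `V/2` and dominates half the sum). [folklore] -/
theorem indicator_add_le_two_mul_add {p q : ℝ} (hp : 0 ≤ p) (hq : 0 ≤ q) (V : ℝ) :
    Set.indicator {y : ℝ | V < y} (fun y => y) (p + q) ≤
      2 * Set.indicator {y : ℝ | V / 2 < y} (fun y => y) p +
        2 * Set.indicator {y : ℝ | V / 2 < y} (fun y => y) q := by
  have hP : 0 ≤ Set.indicator {y : ℝ | V / 2 < y} (fun y => y) p := Set.indicator_apply_nonneg fun _ => hp
  have hQ : 0 ≤ Set.indicator {y : ℝ | V / 2 < y} (fun y => y) q := Set.indicator_apply_nonneg fun _ => hq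
  by_cases hV : V < p + q
  · rw [indicator_of_mem (show p + q ∈ {y : ℝ | V < y} from hV)]
    rcases le_total q p with hqp | hpq
    · have hpV : p ∈ {y : ℝ | V / 2 < y} := by
        show V / 2 < p
        linarith
      rw [indicator_of_mem hpV]
      linarith
    · have hqV : q ∈ {y : ℝ | V / 2 < y} := by
        show V / 2 < q
        linarith
      rw [indicator_of_mem hqV]
      linarith
  · rw [indicator_of_notMem (show p + q ∉ {y : ℝ | V < y} from hV)]
    linarith

/-! ## §2 The abstract `lintegral` step -/

/-- **Tails of a sum from tails of the summands.** If `a_i = p_i + q_i` a.e. with `p_i, q_i ≥ 0`, the `p_i`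
a.e.-measurable, and the normalised tails of `p` and of `q` above `V/2` have mean `≤ ε/4`, then the normalised
tail of `a` above `V` has mean `≤ ε`. [folklore] -/
theorem lintegral_tail_le_of_add {Ω : Type*} [MeasurableSpace Ω] (μ : Measure Ω) {n : ℕ} {V ε : ℝ}
    (hε : 0 ≤ ε) {a p q : Fin (n + 1) → Ω → ℝ} (hp : ∀ i z, 0 ≤ p i z) (hq : ∀ i z, 0 ≤ q i z)
    (hapq : ∀ᵐ z ∂μ, ∀ i, a i z = p i z + q i z) (hpm : ∀ i, AEMeasurable (p i) μ)
    (hP : ∫⁻ z, ENNReal.ofReal (((n : ℝ) + 1)⁻¹ * ∑ i,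
      Set.indicator {y : ℝ | V / 2 < y} (fun y => y) (p i z)) ∂μ ≤ ENNReal.ofReal (ε / 4))
    (hQ : ∫⁻ z, ENNReal.ofReal (((n : ℝ) + 1)⁻¹ * ∑ i,
      Set.indicator {y : ℝ | V / 2 < y} (fun y => y) (q i z)) ∂μ ≤ ENNReal.ofReal (ε / 4)) :
    ∫⁻ z, ENNReal.ofReal (((n : ℝ) + 1)⁻¹ * ∑ i,
      Set.indicator {y : ℝ | V < y} (fun y => y) (a i z)) ∂μ ≤ ENNReal.ofReal ε := by
  have hN : (0 : ℝ) < (n : ℝ) + 1 := by positivity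
  set P : Ω → ℝ := fun z => ((n : ℝ) + 1)⁻¹ * ∑ i, Set.indicator {y : ℝ | V / 2 < y} (fun y => y) (p i z)
    with hPdef
  set Q : Ω → ℝ := fun z => ((n : ℝ) + 1)⁻¹ * ∑ i, Set.indicator {y : ℝ | V / 2 < y} (fun y => y) (q i z)
    with hQdef
  have hP0 : ∀ z, 0 ≤ P z := fun z =>
    mul_nonneg (inv_nonneg.2 hN.le) (Finset.sum_nonneg fun i _ => Set.indicator_apply_nonneg fun _ => hp i z)
  have hQ0 : ∀ z, 0 ≤ Q z := fun z =>
    mul_nonneg (inv_nonneg.2 hN.le) (Finset.sum_nonneg fun i _ => Set.indicator_apply_nonneg fun _ => hq i z)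
  -- a.e.-measurability of the `p`-tail
  have hind : Measurable (Set.indicator {y : ℝ | V / 2 < y} (fun y : ℝ => y)) :=
    measurable_id.indicator measurableSet_Ioi
  have hPm : AEMeasurable P μ :=
    (Finset.aemeasurable_fun_sum Finset.univ fun i _ => hind.comp_aemeasurable (hpm i)).const_mul _
  have hPm' : AEMeasurable (fun z => ENNReal.ofReal 2 * ENNReal.ofReal (P z)) μ :=
    (ENNReal.measurable_ofReal.comp_aemeasurable hPm).const_mul _
  -- the pointwise bound, a.e.
  have hpt : ∀ᵐ z ∂μ, ENNReal.ofReal (((n : ℝ) + 1)⁻¹ * ∑ i,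
      Set.indicator {y : ℝ | V < y} (fun y => y) (a i z)) ≤
      ENNReal.ofReal 2 * ENNReal.ofReal (P z) + ENNReal.ofReal 2 * ENNReal.ofReal (Q z) := by
    filter_upwards [hapq] with z hz
    rw [← ENNReal.ofReal_mul zero_le_two, ← ENNReal.ofReal_mul zero_le_two,
      ← ENNReal.ofReal_add (mul_nonneg zero_le_two (hP0 z)) (mul_nonneg zero_le_two (hQ0 z))]
    refine ENNReal.ofReal_le_ofReal ?_
    calc ((n : ℝ) + 1)⁻¹ * ∑ i, Set.indicator {y : ℝ | V < y} (fun y => y) (a i z)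
        ≤ ((n : ℝ) + 1)⁻¹ * ∑ i, (2 * Set.indicator {y : ℝ | V / 2 < y} (fun y => y) (p i z) +
            2 * Set.indicator {y : ℝ | V / 2 < y} (fun y => y) (q i z)) := by
          refine mul_le_mul_of_nonneg_left (Finset.sum_le_sum fun i _ => ?_) (inv_nonneg.2 hN.le)
          rw [hz i]
          exact indicator_add_le_two_mul_add (hp i z) (hq i z) V
      _ = 2 * P z + 2 * Q z := by
          simp only [hPdef, hQdef, Finset.sum_add_distrib, ← Finset.mul_sum]
          ring
  calc ∫⁻ z, ENNReal.ofReal (((n : ℝ) + 1)⁻¹ * ∑ i, Set.indicator {y : ℝ | V < y} (fun y => y) (a i z)) ∂μ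
      ≤ ∫⁻ z, (ENNReal.ofReal 2 * ENNReal.ofReal (P z) + ENNReal.ofReal 2 * ENNReal.ofReal (Q z)) ∂μ :=
        lintegral_mono_ae hpt
    _ = ENNReal.ofReal 2 * ∫⁻ z, ENNReal.ofReal (P z) ∂μ + ENNReal.ofReal 2 * ∫⁻ z, ENNReal.ofReal (Q z) ∂μ := by
        rw [lintegral_add_left' hPm', lintegral_const_mul' _ _ ENNReal.ofReal_ne_top,
          lintegral_const_mul' _ _ ENNReal.ofReal_ne_top]
    _ ≤ ENNReal.ofReal 2 * ENNReal.ofReal (ε / 4) + ENNReal.ofReal 2 * ENNReal.ofReal (ε / 4) := by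
        gcongr
    _ = ENNReal.ofReal ε := by
        rw [← ENNReal.ofReal_mul zero_le_two, ← ENNReal.ofReal_add (by positivity) (by positivity)]
        congr 1
        ring

/-! ## §3 The transfer activity splits on the good set -/

variable {σ : ℝ} {N : ℕ}

/-- The transfer activity of a particle over a window is its momentum activity plus its energy activity (good
data: finitely many collisions in the window). [folklore] -/
theorem collisionSum_transfer_eq_add (Φ : HardSphereFlow (Torus.geometry (Fin 3)) (hsDiameter σ N) (N + 1))
    {z : Config (N + 1) (Fin 3) T3} (hz : z ∈ Φ.good) (s s' : ℝ) (i : Fin (N + 1)) :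
    Φ.collisionSum (Ioc s s')
        (fun c => if c.fst = i then ‖c.postVel.1 - c.preVel.1‖ + |‖c.postVel.1‖ ^ 2 - ‖c.preVel.1‖ ^ 2| / 2
          else 0) z =
      Φ.collisionSum (Ioc s s') (fun c => if c.fst = i then ‖c.postVel.1 - c.preVel.1‖ else 0) z +
        Φ.collisionSum (Ioc s s')
          (fun c => if c.fst = i then |‖c.postVel.1‖ ^ 2 - ‖c.preVel.1‖ ^ 2| / 2 else 0) z := by
  -- adapted from `HydroLimitInBandContinuity.sum_collisionSum_transfer_eq` (one particle at a time)
  have hfin := Φ.finite_collisionTimes_inter hz (S := Ioc s s') Ioc_subset_Icc_self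
  simp only [HardSphereFlow.collisionSum_eq, collisionSum_eq_collisionPairSum]
  rw [← collisionPairSum_add hfin]
  congr 1
  funext t k l
  split_ifs <;> simp

/-! ## §4 The stub -/

/-- **CC3 — transfer-activity tails from the momentum-activity tails (CAT) and the energy-activity tails (CEAT).**
`σ₀ := min (σ₀ᵐ, σ₀ᵉ, 1/2)`, `V₀ := 2 max (V₀ᵐ, V₀ᵉ)`, both inputs at level `V/2` and accuracy `ε/4`,
`τ₀ := max`, `N₀ := max`; then `lintegral_tail_le_of_add` with the splitting `collisionSum_transfer_eq_add` on the
good set (full local Gibbs measure) and the a.e.-measurability of the momentum activity. [folklore] -/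
theorem stub_transferActivityTails : TransferActivityTailsOf := by
  intro hCAT hCEAT a₀ θ₀ u₀ ha hθ hu ha0 hθ0
  obtain ⟨σ₁, hσ₁, h1⟩ := hCAT a₀ θ₀ u₀ ha hθ hu ha0 hθ0
  obtain ⟨σ₂, hσ₂, h2⟩ := hCEAT a₀ θ₀ u₀ ha hθ hu ha0 hθ0
  refine ⟨min (min σ₁ σ₂) (1 / 2), lt_min (lt_min hσ₁ hσ₂) one_half_pos, ?_⟩
  intro σ hσ hσlt T ρ θ u hE Φ hlim t ht
  have hσ12 : σ < min σ₁ σ₂ := hσlt.trans_le (min_le_left _ _)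
  have hσh : σ < 1 / 2 := hσlt.trans_le (min_le_right _ _)
  obtain ⟨V₁, hV₁, hm⟩ := h1 σ hσ (hσ12.trans_le (min_le_left _ _)) T ρ θ u hE Φ hlim t ht
  obtain ⟨V₂, hV₂, he⟩ := h2 σ hσ (hσ12.trans_le (min_le_right _ _)) T ρ θ u hE Φ hlim t ht
  refine ⟨2 * max V₁ V₂, by positivity, ?_⟩
  intro V hV ε hε
  have hV1 : V₁ ≤ V / 2 := by
    have := le_max_left V₁ V₂
    linarith
  have hV2 : V₂ ≤ V / 2 := by
    have := le_max_right V₁ V₂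
    linarith
  obtain ⟨τ₁, hτ₁, hm'⟩ := hm (V / 2) hV1 (ε / 4) (by positivity)
  obtain ⟨τ₂, hτ₂, he'⟩ := he (V / 2) hV2 (ε / 4) (by positivity)
  refine ⟨max τ₁ τ₂, lt_max_of_lt_left hτ₁, ?_⟩
  intro τ hτ
  have hτ0 : 0 < τ := hτ₁.trans_le ((le_max_left _ _).trans hτ)
  obtain ⟨N₁, hm''⟩ := hm' τ ((le_max_left _ _).trans hτ)
  obtain ⟨N₂, he''⟩ := he' τ ((le_max_right _ _).trans hτ)
  refine ⟨max N₁ N₂, ?_⟩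
  intro N hN s hs
  have hM := hm'' N ((le_max_left _ _).trans hN) s hs
  have hEn := he'' N ((le_max_right _ _).trans hN) s hs
  dsimp only at hM hEn ⊢
  have hκ : 0 ≤ σ / τ := div_nonneg hσ.le hτ0.le
  -- the local Gibbs law gives full mass to the good set (it is Liouville-absolutely continuous)
  have hgood : ∀ᵐ z ∂(localGibbsLaw σ a₀ u₀ θ₀ N (Φ N)), z ∈ (Φ N).good := by
    rw [localGibbsLaw_eq]
    exact (localGibbsMeasure_absolutelyContinuous σ a₀ u₀ θ₀ N (Φ N)).ae_le (Φ N).ae_mem_good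
  -- a scaled collision sum of a nonnegative functional is nonnegative (every datum)
  have hnn : ∀ (F : HardSphereCollisionRecord (Fin 3) T3 (N + 1) → ℝ), (∀ c, 0 ≤ F c) →
      ∀ (S : Set ℝ) (z : Config (N + 1) (Fin 3) T3), 0 ≤ σ / τ * (Φ N).collisionSum S F z := by
    intro F hF S z
    refine mul_nonneg hκ ?_
    simp only [HardSphereFlow.collisionSum_eq, collisionSum_eq_collisionPairSum]
    exact collisionPairSum_nonneg fun _ _ _ => hF _
  -- the momentum activity is a.e.-measurable in the datum: on the collisions of an orbit
  -- `‖v_fst⁺ − v_fst⁻‖ = ‖⟪v_fst⁻ − v_snd⁻, ω⟫ ω‖` is a continuous function of the mark (elastic law), so the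
  -- label-aware engine `HardSphereFlow.aemeasurable_of_eqOn_collisionSum_labels_torus` applies
  -- (adapted from 9133's `HydroLimitInBandContinuity.aemeasurable_momActivity`)
  have hmeas : ∀ (i : Fin (N + 1)) (a b : ℝ), AEMeasurable (fun z => (Φ N).collisionSum (Ioc a b)
      (fun c => if c.fst = i then ‖c.postVel.1 - c.preVel.1‖ else 0) z) (localGibbsLaw σ a₀ u₀ θ₀ N (Φ N)) := by
    intro i a b
    have hε : hsDiameter σ N < 2⁻¹ := (hsDiameter_le hσ.le N).trans_lt (by rw [inv_eq_one_div]; exact hσh)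
    have hε0 : 0 < hsDiameter σ N := hsDiameter_pos hσ N
    have hFc : ∀ k l : Fin (N + 1), Continuous fun m : ℝ × T3 × V3 × V3 × V3 =>
        if k = i then ‖⟪m.2.2.2.1 - m.2.2.2.2, m.2.2.1⟫_ℝ • m.2.2.1‖ else 0 := by
      intro k l
      by_cases hk : k = i
      · simp only [hk, if_true]
        fun_prop
      · simp only [hk, if_false]
        exact continuous_const
    refine (Φ N).aemeasurable_of_eqOn_collisionSum_labels_torus hε hFc a b (fun z _ => ?_) hgood
    rw [HardSphereFlow.collisionSum_eq, HardSphereFlow.collisionSum_eq]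
    refine collisionSum_congr fun t _ p hp => ?_
    obtain ⟨-, hc⟩ := mem_contactPairs.1 hp
    by_cases hpi : p.1 = i
    · have hpost := congrArg Prod.fst (ofConfig_postVel_eq_of_mem_contactSet hε0 t hc)
      simp only [HardSphereCollisionRecord.ofConfig_fst, HardSphereCollisionRecord.mark_def]
      rw [if_pos hpi, if_pos hpi, hpost, sub_sub_cancel_left, norm_neg]
    · simp only [HardSphereCollisionRecord.ofConfig_fst]
      rw [if_neg hpi, if_neg hpi]
  refine lintegral_tail_le_of_add (localGibbsLaw σ a₀ u₀ θ₀ N (Φ N)) hε.le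
    (a := fun i z => σ / τ * (Φ N).collisionSum (Set.Ioc s (s + τ * ((N : ℝ) + 1) ^ (-(1 / 3 : ℝ))))
      (fun c => if c.fst = i then ‖c.postVel.1 - c.preVel.1‖ + |‖c.postVel.1‖ ^ 2 - ‖c.preVel.1‖ ^ 2| / 2
        else 0) z)
    (p := fun i z => σ / τ * (Φ N).collisionSum (Set.Ioc s (s + τ * ((N : ℝ) + 1) ^ (-(1 / 3 : ℝ))))
      (fun c => if c.fst = i then ‖c.postVel.1 - c.preVel.1‖ else 0) z)
    (q := fun i z => σ / τ * (Φ N).collisionSum (Set.Ioc s (s + τ * ((N : ℝ) + 1) ^ (-(1 / 3 : ℝ))))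
      (fun c => if c.fst = i then |‖c.postVel.1‖ ^ 2 - ‖c.preVel.1‖ ^ 2| / 2 else 0) z)
    (fun i z => hnn _ (fun c => by positivity) _ z) (fun i z => hnn _ (fun c => by positivity) _ z)
    ?_ (fun i => (hmeas i _ _).const_mul _) hM hEn
  filter_upwards [hgood] with z hz
  intro i
  rw [collisionSum_transfer_eq_add (Φ N) hz, mul_add]

end Summit.AtomisticToContinuum.HydrodynamicLimit.Theorems.ClampedCurrentsDockTransferTails

end
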